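import Mathlib
import Summits.Ventures.PercRepro.TriangleCapRowJMixedArith
import Summits.Ventures.PercRepro.TriangleCapVertexBound
import Summits.Ventures.PercRepro.TriangleCapRowA2Last

/-!
# PercRepro — EVERY ROW `r = a + j`: THE PIECES — the concavity of the vertex bound, the window, the all-off read
through the level-`j` stability, the sides of an `a`-bipartite `D − z`, and the vertex-bound mixed core
(p3, gen 48; part 202f)

`concave_endpoint`: `(s − x)(x − 1)` on `lo ≤ x ≤ hi` is at least its value at one of the endpoints.
`rowJ_window`: every degree in `[a, k − a − 1]` gives the `(j + 1)`-broom target on `(k, a, a + j)`.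
`rowJ_alloff`: every neighbour of `z` off the `a`-side of `D − z` makes `D` `(a + 1)`-bipartite with
`s = k − a − 1 + j` missing pairs, none at a vertex missing `s − j − 1` of them, and the level-`j` stability
(`closed_form_stability_bipSub_level`) gives the target EXACTLY. `sides_J_gen`: `D` is `a`-bipartite, or at the target,
or `z` has a neighbour on each side and `T + (k − a − 2) ≤ d (k − a − 2) + a`. `mixed_vertex_core`: with a neighbour on
each side, `t` in-side and `s₀` off-side neighbours, and `x` the missing degree of an off-side neighbour `w₀` in the
missing graph of `D − z` (`t ≤ x + 1` by `K₄⁻`), the vertex bound on `D − z` and both `K₄⁻` degree bounds on `T` — the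
input of the six arithmetic lemmas of part 202e. Axioms: standard.
-/

namespace PercRepro

namespace TriangleCap

namespace C047

open Finset

/-- **CONCAVITY OF THE VERTEX BOUND:** for `lo ≤ x ≤ hi`, `(s − x)(x − 1)` is at least `(s − lo)(lo − 1)` or at least
`(s − hi)(hi − 1)`. -/
theorem concave_endpoint (s lo hi x : ℕ) (h1 : lo ≤ x) (h2 : x ≤ hi) :
    (s - lo) * (lo - 1) ≤ (s - x) * (x - 1) ∨ (s - hi) * (hi - 1) ≤ (s - x) * (x - 1) := by
  rcases Nat.eq_zero_or_pos lo with hlo | hlo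
  · left
    subst hlo
    simp
  rcases Nat.lt_or_ge s hi with hsh | hsh
  · right
    have : s - hi = 0 := by omega
    rw [this, zero_mul]
    exact Nat.zero_le _
  · obtain ⟨p, rfl⟩ : ∃ p, x = lo + p := ⟨x - lo, by omega⟩
    obtain ⟨q, rfl⟩ : ∃ q, hi = lo + p + q := ⟨hi - (lo + p), by omega⟩
    obtain ⟨e, rfl⟩ : ∃ e, s = lo + p + q + e := ⟨s - (lo + p + q), by omega⟩
    obtain ⟨l, rfl⟩ : ∃ l, lo = l + 1 := ⟨lo - 1, by omega⟩
    have e1 : l + 1 + p + q + e - (l + 1) = p + q + e := by omega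
    have e2 : l + 1 - 1 = l := by omega
    have e3 : l + 1 + p + q + e - (l + 1 + p) = q + e := by omega
    have e4 : l + 1 + p - 1 = l + p := by omega
    have e5 : l + 1 + p + q + e - (l + 1 + p + q) = e := by omega
    have e6 : l + 1 + p + q - 1 = l + p + q := by omega
    rw [e1, e2, e3, e4, e5, e6]
    rcases Nat.lt_or_ge (q + e) l with h | h
    · -- `l > q + e`: `g(x) − g(hi) = q (l + p − e) ≥ 0`
      right
      obtain ⟨f, hf⟩ : ∃ f, l + p = e + f := ⟨l + p - e, by omega⟩
      have : e * (l + p + q) + q * f = (q + e) * (l + p) := by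
        have h2 : l + p = e + f := hf
        rw [h2]; ring
      omega
    · -- `g(x) − g(lo) = p (q + e − l) ≥ 0`
      left
      obtain ⟨f, hf⟩ : ∃ f, q + e = l + f := ⟨q + e - l, by omega⟩
      have h3 : p * (q + e) = p * (l + f) := by rw [hf]
      nlinarith [h3, Nat.zero_le (p * f)]

/-- **CONCAVITY OF THE VERTEX BOUND WITH THE LINEAR TERM:** for `lo ≤ x ≤ hi ≤ s`, `2 (s − x)(x − 1) + 2x` is at
least its value at `lo` or at `hi`. -/
theorem concave_endpoint' (s lo hi x : ℕ) (h1 : lo ≤ x) (h2 : x ≤ hi) (hhi : hi ≤ s) :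
    2 * ((s - lo) * (lo - 1)) + 2 * lo ≤ 2 * ((s - x) * (x - 1)) + 2 * x ∨
      2 * ((s - hi) * (hi - 1)) + 2 * hi ≤ 2 * ((s - x) * (x - 1)) + 2 * x := by
  rcases Nat.eq_zero_or_pos lo with hlo | hlo
  · left
    subst hlo
    simp
  obtain ⟨p, rfl⟩ : ∃ p, x = lo + p := ⟨x - lo, by omega⟩
  obtain ⟨q, rfl⟩ : ∃ q, hi = lo + p + q := ⟨hi - (lo + p), by omega⟩
  obtain ⟨e, rfl⟩ : ∃ e, s = lo + p + q + e := ⟨s - (lo + p + q), by omega⟩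
  obtain ⟨l, rfl⟩ : ∃ l, lo = l + 1 := ⟨lo - 1, by omega⟩
  have e1 : l + 1 + p + q + e - (l + 1) = p + q + e := by omega
  have e2 : l + 1 - 1 = l := by omega
  have e3 : l + 1 + p + q + e - (l + 1 + p) = q + e := by omega
  have e4 : l + 1 + p - 1 = l + p := by omega
  have e5 : l + 1 + p + q + e - (l + 1 + p + q) = e := by omega
  have e6 : l + 1 + p + q - 1 = l + p + q := by omega
  rw [e1, e2, e3, e4, e5, e6]
  -- `h(x) − h(lo) = 2p (q + e + 1 − l)`, `h(x) − h(hi) = 2q (l + p + 1 − e)`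
  rcases Nat.lt_or_ge (q + e + 1) l with h | h
  · right
    obtain ⟨f, hf⟩ : ∃ f, l + p + 1 = e + f := ⟨l + p + 1 - e, by omega⟩
    have h3 : q * (l + p + 1) = q * (e + f) := by rw [hf]
    nlinarith [h3, Nat.zero_le (q * f)]
  · left
    obtain ⟨f, hf⟩ : ∃ f, q + e + 1 = l + f := ⟨q + e + 1 - l, by omega⟩
    have h3 : p * (q + e + 1) = p * (l + f) := by rw [hf]
    nlinarith [h3, Nat.zero_le (p * f)]

variable {V : Type*} [Fintype V] [DecidableEq V]

omit [DecidableEq V] in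
/-- **THE WINDOW `[a, k − a − 1]` ON `(k, a, a + j)`:** every degree in `[a, k − a − 1]` gives the `(j + 1)`-broom
target (`a ≥ j + 5`, `k ≥ 3a + j`). -/
theorem rowJ_window (D : SimpleGraph V) [DecidableRel D.Adj] (a j : ℕ) (ha : j + 5 ≤ a)
    (hk : 3 * a + j ≤ Fintype.card V) (hm : D.edgeFinset.card + (a + j) = a * (Fintype.card V - a))
    (hcap : ∀ v, deg D v + a + 1 ≤ Fintype.card V) (hdeg : ∀ v, a ≤ deg D v) :
    ∑ v, deg D v * deg D v + (a + j) * (Fintype.card V - 1 - (a + j)) +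
        (2 * (Fintype.card V - a - 3) + 2 * j * (a - 2)) ≤
      D.edgeFinset.card * Fintype.card V := by
  have hsum : ∑ v, (deg D v * deg D v + a * (Fintype.card V - a - 1)) ≤ ∑ v, (Fintype.card V - 1) * deg D v :=
    sum_le_sum (fun v _ => convex_vertex_window (deg D v) (Fintype.card V) a (hdeg v) (hcap v))
  rw [sum_add_distrib, sum_const, card_univ, smul_eq_mul, ← mul_sum, sum_deg_eq] at hsum
  obtain ⟨k, hk'⟩ : ∃ k, Fintype.card V = k := ⟨_, rfl⟩
  obtain ⟨S, hS⟩ : ∃ S, ∑ v, deg D v * deg D v = S := ⟨_, rfl⟩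
  obtain ⟨m, hmdef⟩ : ∃ m, D.edgeFinset.card = m := ⟨_, rfl⟩
  rw [hk'] at hsum hm hk
  rw [hS, hmdef] at hsum
  rw [hmdef] at hm
  rw [hS, hk', hmdef]
  obtain ⟨w, rfl⟩ : ∃ w, a = j + 5 + w := ⟨a - (j + 5), by omega⟩
  obtain ⟨c, rfl⟩ : ∃ c, k = 3 * (j + 5 + w) + j + c := ⟨k - (3 * (j + 5 + w) + j), by omega⟩
  have e1 : 3 * (j + 5 + w) + j + c - (j + 5 + w) - 1 = 3 * j + 9 + 2 * w + c := by omega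
  have e2 : 3 * (j + 5 + w) + j + c - 1 = 4 * j + 14 + 3 * w + c := by omega
  have e3 : 3 * (j + 5 + w) + j + c - (j + 5 + w) = 3 * j + 10 + 2 * w + c := by omega
  have e4 : 3 * (j + 5 + w) + j + c - 1 - (j + 5 + w + j) = 2 * j + 9 + 2 * w + c := by omega
  have e5 : 3 * (j + 5 + w) + j + c - (j + 5 + w) - 3 = 3 * j + 7 + 2 * w + c := by omega
  have e6 : j + 5 + w - 2 = j + 3 + w := by omega
  rw [e1, e2] at hsum
  rw [e3] at hm
  rw [e4, e5, e6]
  nlinarith [hsum, hm, Nat.zero_le (j * w), Nat.zero_le (j * c), Nat.zero_le (w * c), Nat.zero_le (j * j),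
    Nat.zero_le (w * w)]

/-- **THE ALL-OFF READ ON `(k, a, a + j)`:** `D − z ⊆ K(A′, A′ᶜ)`, every neighbour of `z` off `A′`, some neighbour
`w₀` ⇒ the target, EXACTLY (the other bipartition has `s = k − a − 1 + j` missing pairs, no vertex missing `s − j − 1`
of them, and the level-`j` stability gives `s (k − 1 − s) + 2 (j + 1)(s − j − 2) = (a + j)(k − 1 − (a + j)) +
2 (k − a − 3) + 2j (a − 2)`). -/
theorem rowJ_alloff (D : SimpleGraph V) [DecidableRel D.Adj] (a j : ℕ) (ha : j + 5 ≤ a)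
    (hk : 3 * a + j ≤ Fintype.card V) (hm : D.edgeFinset.card + (a + j) = a * (Fintype.card V - a)) (z : V)
    (hz : deg D z + 1 ≤ a) (A' : Finset {v : V // v ≠ z}) (hA'card : A'.card = a) (hB : BipSub (del D z) A')
    (hm' : (del D z).edgeFinset.card + (deg D z + j) = a * (Fintype.card {v : V // v ≠ z} - a))
    (hnone : ∀ w : {v : V // v ≠ z}, D.Adj w.1 z → w ∉ A') (w₀ : {v : V // v ≠ z}) (hw₀z : D.Adj w₀.1 z) :
    ∑ v, deg D v * deg D v + (a + j) * (Fintype.card V - 1 - (a + j)) +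
        (2 * (Fintype.card V - a - 3) + 2 * j * (a - 2)) ≤
      D.edgeFinset.card * Fintype.card V := by
  have hcard' := card_del z
  have hz1 : 1 ≤ deg D z := by
    have := card_nbhd_del D z
    have hmem : w₀ ∈ univ.filter (fun w : {v : V // v ≠ z} => D.Adj w.1 z) := by
      rw [mem_filter]; exact ⟨mem_univ _, hw₀z⟩
    have := card_pos.mpr ⟨w₀, hmem⟩
    omega
  have hAsub := bipSub_insert_map D z A' hB hnone
  have hAcard := card_insert_map z A'
  rw [hA'card] at hAcard
  have hedges : D.edgeFinset.card + (Fintype.card V - a - 1 + j) = (a + 1) * (Fintype.card V - (a + 1)) := by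
    have h := below_bip_edges a (a + j) (Fintype.card V) D.edgeFinset.card (by omega) hm
    have e : Fintype.card V - 2 * a - 1 + (a + j) = Fintype.card V - a - 1 + j := by omega
    rw [e] at h
    exact h
  have hmissdel := card_edges_missingGraph (del D z) A' hB a (deg D z + j) hA'card hm'
  have hmax : ∀ v, deg (missingGraph D (insert z (A'.map (Function.Embedding.subtype _)))) v + j + 1 ≤
      Fintype.card V - a - 1 + j := by
    intro v
    have h := deg_add_deg_missingGraph D _ hAsub v
    rw [hAcard] at h
    by_cases hvA : v ∈ insert z (A'.map (Function.Embedding.subtype _))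
    · rw [if_pos hvA] at h
      have hdeg1 : 1 ≤ deg D v := by
        rw [mem_insert, mem_map] at hvA
        rcases hvA with rfl | ⟨w, hwA, hwv⟩
        · exact hz1
        · have hdel := deg_del D z w
          have hwz : ¬ D.Adj w.1 z := fun h => hnone w h hwA
          rw [if_neg hwz, add_zero] at hdel
          have hmiss := deg_add_deg_missingGraph (del D z) A' hB w
          rw [if_pos hwA, hA'card] at hmiss
          have ec : Fintype.card {v : V // v ≠ z} = Fintype.card V - 1 := by omega
          rw [ec] at hmiss
          have hle := deg_le_card_edges' (missingGraph (del D z) A') w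
          rw [hmissdel] at hle
          simp only [Function.Embedding.coe_subtype] at hwv
          rw [← hwv, ← hdel]
          omega
      omega
    · rw [if_neg hvA] at h
      omega
  have h := closed_form_stability_bipSub_level D _ hAsub (a + 1) (Fintype.card V - a - 1 + j) j hAcard hedges
    (by omega) (by omega) hmax
  have e1 : Fintype.card V - 1 - (Fintype.card V - a - 1 + j) = a - j := by omega
  rw [e1] at h
  have e2 : (Fintype.card V - a - 1 + j) * (a - j) + 2 * ((j + 1) * (Fintype.card V - a - 1 + j - j - 2)) =
      (a + j) * (Fintype.card V - 1 - (a + j)) + (2 * (Fintype.card V - a - 3) + 2 * j * (a - 2)) := by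
    obtain ⟨w, rfl⟩ : ∃ w, a = j + 5 + w := ⟨a - (j + 5), by omega⟩
    obtain ⟨c, hc⟩ : ∃ c, Fintype.card V = 3 * (j + 5 + w) + j + c := ⟨Fintype.card V - (3 * (j + 5 + w) + j), by omega⟩
    rw [hc]
    have f1 : 3 * (j + 5 + w) + j + c - (j + 5 + w) - 1 + j = 4 * j + 9 + 2 * w + c := by omega
    have f2 : j + 5 + w - j = 5 + w := by omega
    have f3 : 4 * j + 9 + 2 * w + c - j - 2 = 3 * j + 7 + 2 * w + c := by omega
    have f4 : 3 * (j + 5 + w) + j + c - 1 - (j + 5 + w + j) = 2 * j + 9 + 2 * w + c := by omega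
    have f5 : 3 * (j + 5 + w) + j + c - (j + 5 + w) - 3 = 3 * j + 7 + 2 * w + c := by omega
    have f6 : j + 5 + w - 2 = j + 3 + w := by omega
    rw [f1, f2, f3, f4, f5, f6]
    ring
  omega

/-- **THE SIDES OF AN `a`-BIPARTITE `D − z` ON `(k, a, a + j)`:** `D` is `a`-bipartite, or at the target (all
neighbours of `z` off the side), or `z` has a neighbour `w₀` off the side and a neighbour `w₁` on it, `2 ≤ d(z)`, and
`T + (k − a − 2) ≤ d(z)(k − a − 2) + a`. -/
theorem sides_J_gen (D : SimpleGraph V) [DecidableRel D.Adj] (a j : ℕ) (ha : j + 5 ≤ a)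
    (hk : 3 * a + j ≤ Fintype.card V) (hm : D.edgeFinset.card + (a + j) = a * (Fintype.card V - a)) (z : V)
    (hz : deg D z + 1 ≤ a) (A' : Finset {v : V // v ≠ z}) (hA'card : A'.card = a) (hB : BipSub (del D z) A')
    (hm' : (del D z).edgeFinset.card + (deg D z + j) = a * (Fintype.card {v : V // v ≠ z} - a))
    (hcap : ∀ v, deg D v ≤ (Fintype.card V - a - 2) + 1) :
    (∃ A : Finset V, A.card = a ∧ BipSub D A) ∨
      (∑ v, deg D v * deg D v + (a + j) * (Fintype.card V - 1 - (a + j)) +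
          (2 * (Fintype.card V - a - 3) + 2 * j * (a - 2)) ≤ D.edgeFinset.card * Fintype.card V) ∨
      (2 ≤ deg D z ∧ (∃ w₀ : {v : V // v ≠ z}, w₀ ∉ A' ∧ D.Adj w₀.1 z) ∧
        (∃ w₁ : {v : V // v ≠ z}, w₁ ∈ A' ∧ D.Adj w₁.1 z) ∧
        ∑ w : {v : V // v ≠ z}, (if D.Adj w.1 z then deg (del D z) w else 0) + (Fintype.card V - a - 2) ≤
          deg D z * (Fintype.card V - a - 2) + a) := by
  by_cases hall : ∀ w : {v : V // v ≠ z}, D.Adj w.1 z → w ∈ A'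
  · obtain ⟨B, hBcard, hBsub⟩ := bipSub_lift D z A' hB hall
    exact Or.inl ⟨B, by rw [hBcard, hA'card], hBsub⟩
  by_cases hnone : ∀ w : {v : V // v ≠ z}, D.Adj w.1 z → w ∉ A'
  · right; left
    push Not at hall
    obtain ⟨w₀, hw₀z, _⟩ := hall
    exact rowJ_alloff D a j ha hk hm z hz A' hA'card hB hm' hnone w₀ hw₀z
  · right; right
    push Not at hall hnone
    obtain ⟨w₀, hw₀z, hw₀A⟩ := hall
    obtain ⟨w₁, hw₁z, hw₁A⟩ := hnone
    have hne : w₀ ≠ w₁ := fun h => hw₀A (h ▸ hw₁A)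
    obtain ⟨Nz, hNzdef⟩ : ∃ Nz : Finset {v : V // v ≠ z},
        Nz = univ.filter (fun w : {v : V // v ≠ z} => D.Adj w.1 z) := ⟨_, rfl⟩
    have hmemNz : ∀ w : {v : V // v ≠ z}, w ∈ Nz ↔ D.Adj w.1 z := fun w => by
      rw [hNzdef, mem_filter]
      simp only [mem_univ, true_and]
    have hNz : Nz.card = deg D z := by rw [hNzdef]; exact card_nbhd_del D z
    refine ⟨?_, ⟨w₀, hw₀A, hw₀z⟩, ⟨w₁, hw₁A, hw₁z⟩, ?_⟩
    · have hsub : ({w₀, w₁} : Finset {v : V // v ≠ z}) ⊆ Nz := by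
        intro w hw
        rw [mem_insert, mem_singleton] at hw
        rcases hw with rfl | rfl
        · exact (hmemNz _).mpr hw₀z
        · exact (hmemNz _).mpr hw₁z
      have := card_le_card hsub
      rw [card_pair hne] at this
      omega
    · have hTfilt : ∑ w : {v : V // v ≠ z}, (if D.Adj w.1 z then deg (del D z) w else 0) =
          ∑ w ∈ Nz, deg (del D z) w := by
        rw [hNzdef, sum_filter]
      rw [hTfilt, ← hNz]
      have hdw₀ : deg (del D z) w₀ ≤ a := by
        have := deg_le_card_of_bipSub (del D z) A' hB w₀ hw₀A
        rw [hA'card] at this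
        exact this
      exact sum_le_of_mem_le_gen Nz (fun w => deg (del D z) w) (Fintype.card V - a - 2) a ((hmemNz w₀).mpr hw₀z)
        (fun w hw => by
          have h := deg_del D z w
          rw [if_pos ((hmemNz w).mp hw)] at h
          have := hcap w.1
          omega) hdw₀

/-- **THE VERTEX-BOUND MIXED CORE** (`D − z ⊆ K(A′, A′ᶜ)`, `|A′| = a`, `r′` missing pairs, a neighbour `w₀` of `z` off
the side and a neighbour `w₁` on it, no vertex at the cap): with `t` in-side and `s₀` off-side neighbours of `z` and
`x` the missing degree of `w₀`: `t ≤ x + 1`, `x ≤ r′`, `x ≤ a`, the vertex bound on `D − z`, and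
`T ≤ t (k − a − 2) + (a − x) + (s₀ − 1)(a + 1 − t)` as well as `T ≤ t (k − a − s₀) + (a − x) + (s₀ − 1)(a + 1 − t)`. -/
theorem mixed_vertex_core (D : SimpleGraph V) [DecidableRel D.Adj] (hK : K4mFree D) (a : ℕ)
    (hk : 2 * a + 3 ≤ Fintype.card V) (z : V) (A' : Finset {v : V // v ≠ z}) (hA'card : A'.card = a)
    (hB : BipSub (del D z) A') (r' : ℕ) (hr' : r' + 1 ≤ Fintype.card {v : V // v ≠ z})
    (hm' : (del D z).edgeFinset.card + r' = a * (Fintype.card {v : V // v ≠ z} - a))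
    (hcap : ∀ v, deg D v ≤ (Fintype.card V - a - 2) + 1) (w₀ : {v : V // v ≠ z}) (hw₀A : w₀ ∉ A')
    (hw₀z : D.Adj w₀.1 z) (w₁ : {v : V // v ≠ z}) (hw₁A : w₁ ∈ A') (hw₁z : D.Adj w₁.1 z) :
    ∃ t s₀ x, t + s₀ = deg D z ∧ 1 ≤ t ∧ 1 ≤ s₀ ∧ t ≤ x + 1 ∧ x ≤ r' ∧ x ≤ a ∧
      (∑ w : {v : V // v ≠ z}, deg (del D z) w * deg (del D z) w +
          r' * (Fintype.card {v : V // v ≠ z} - 1 - r') + 2 * ((r' - x) * (x - 1)) ≤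
        (del D z).edgeFinset.card * Fintype.card {v : V // v ≠ z}) ∧
      (∑ w : {v : V // v ≠ z}, (if D.Adj w.1 z then deg (del D z) w else 0) ≤
        t * (Fintype.card V - a - 2) + (a - x) + (s₀ - 1) * (a + 1 - t)) ∧
      (∑ w : {v : V // v ≠ z}, (if D.Adj w.1 z then deg (del D z) w else 0) ≤
        t * (Fintype.card V - a - s₀) + (a - x) + (s₀ - 1) * (a + 1 - t)) := by
  have hcard' := card_del z
  obtain ⟨Nz, hNzdef⟩ : ∃ Nz : Finset {v : V // v ≠ z},
      Nz = univ.filter (fun w : {v : V // v ≠ z} => D.Adj w.1 z) := ⟨_, rfl⟩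
  have hmemNz : ∀ w : {v : V // v ≠ z}, w ∈ Nz ↔ D.Adj w.1 z := fun w => by
    rw [hNzdef, mem_filter]
    simp only [mem_univ, true_and]
  have hNz : Nz.card = deg D z := by rw [hNzdef]; exact card_nbhd_del D z
  have hTfilt : ∑ w : {v : V // v ≠ z}, (if D.Adj w.1 z then deg (del D z) w else 0) =
      ∑ w ∈ Nz, deg (del D z) w := by
    rw [hNzdef, sum_filter]
  rw [hTfilt]
  have hdegNz : ∀ w ∈ Nz, deg (del D z) w + 1 ≤ Fintype.card V - a - 1 := fun w hw => by
    have h := deg_del D z w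
    rw [if_pos ((hmemNz w).mp hw)] at h
    have := hcap w.1
    omega
  obtain ⟨I, hI⟩ : ∃ I : Finset {v : V // v ≠ z}, I = Nz.filter (fun w => w ∈ A') := ⟨_, rfl⟩
  obtain ⟨O, hO⟩ : ∃ O : Finset {v : V // v ≠ z}, O = Nz.filter (fun w => w ∉ A') := ⟨_, rfl⟩
  have hIO : I.card + O.card = deg D z := by
    rw [hI, hO, card_filter_add_card_filter_not, hNz]
  have hIeq : I = A'.filter (fun w => D.Adj w.1 z) := by
    rw [hI]
    ext w
    rw [mem_filter, mem_filter, hmemNz]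
    tauto
  have hOeq : O = A'ᶜ.filter (fun w => D.Adj w.1 z) := by
    rw [hO]
    ext w
    rw [mem_filter, mem_filter, hmemNz, mem_compl]
    tauto
  have hTsplit : ∑ w ∈ Nz, deg (del D z) w = ∑ w ∈ I, deg (del D z) w + ∑ w ∈ O, deg (del D z) w := by
    rw [hI, hO, sum_filter_add_sum_filter_not]
  have hTI : ∑ w ∈ I, deg (del D z) w ≤ I.card * (Fintype.card V - a - 2) := by
    rw [← smul_eq_mul, ← sum_const]
    apply sum_le_sum
    intro w hw
    have := hdegNz w (mem_of_mem_filter w (hI ▸ hw))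
    omega
  have hin : ∀ u ∈ I, deg (del D z) u + O.card ≤ (Fintype.card V - a - 1) + 1 := fun u hu => by
    rw [hI, mem_filter, hmemNz] at hu
    have h := inside_deg_bound D hK z A' hB u hu.2 hu.1
    rw [← hOeq, card_compl, hA'card] at h
    have : Fintype.card {v : V // v ≠ z} - a = Fintype.card V - a - 1 := by omega
    rw [this] at h
    exact h
  have hTI' : ∑ w ∈ I, deg (del D z) w ≤ I.card * (Fintype.card V - a - O.card) := by
    rw [← smul_eq_mul, ← sum_const]
    apply sum_le_sum
    intro w hw
    have := hin w hw
    omega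
  have hoff : ∀ w ∈ O, deg (del D z) w + I.card ≤ a + 1 := fun w hw => by
    rw [hO, mem_filter, hmemNz] at hw
    have h := offside_deg_bound D hK z A' hB w hw.2 hw.1
    rw [← hIeq, hA'card] at h
    exact h
  have hw₀O : w₀ ∈ O := by rw [hO, mem_filter, hmemNz]; exact ⟨hw₀z, hw₀A⟩
  have hw₁I : w₁ ∈ I := by rw [hI, mem_filter, hmemNz]; exact ⟨hw₁z, hw₁A⟩
  have hO1 : 1 ≤ O.card := card_pos.mpr ⟨w₀, hw₀O⟩
  have hI1 : 1 ≤ I.card := card_pos.mpr ⟨w₁, hw₁I⟩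
  -- the missing degree `x` of `w₀`
  have hsum₀ := deg_add_deg_missingGraph (del D z) A' hB w₀
  rw [if_neg hw₀A, hA'card] at hsum₀
  have hxr := deg_le_card_edges' (missingGraph (del D z) A') w₀
  rw [card_edges_missingGraph (del D z) A' hB a r' hA'card hm'] at hxr
  have hTO : ∑ w ∈ O, deg (del D z) w ≤ (a - deg (missingGraph (del D z) A') w₀) + (O.card - 1) * (a + 1 - I.card) := by
    rw [← add_sum_erase O _ hw₀O]
    have h1 : ∑ w ∈ O.erase w₀, deg (del D z) w ≤ ∑ _w ∈ O.erase w₀, (a + 1 - I.card) :=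
      sum_le_sum (fun w hw => by have := hoff w (mem_of_mem_erase hw); omega)
    rw [sum_const, smul_eq_mul, card_erase_of_mem hw₀O] at h1
    omega
  have hS := closed_form_stability_bipSub_vertex (del D z) A' hB a r' hA'card hm' hr' w₀
  refine ⟨I.card, O.card, deg (missingGraph (del D z) A') w₀, hIO, hI1, hO1, ?_, hxr, by omega, hS, ?_, ?_⟩
  · have := hoff w₀ hw₀O
    omega
  · rw [hTsplit]
    omega
  · rw [hTsplit]
    omega

end C047

end TriangleCap

end PercRepro
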